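import Mathlib
import Summits.KontsevichZagierPeriods.Zeta5Search.CollinearityCriterionProof
import HarnessLib

/-!
# ζ(5) search — the SHARPNESS TOOL of the first-digit determinant: `D̄ ≠ 0 ⇒ v_p(Cas_j(b)) = 3 − 2N` EXACTLY
# (the converse bookkeeping of gen-2 g9 / typer g10's collinearity criterion `collinearityCriterionT_holds`; REPORT-gen2-g23 §5 (i), REPORT-gen2-g24)

Cell `pub-zeta5` (HONEST FRAMING: systematic search; no irrationality claim unless certified), designer lineage gen-2, generation 24.
Every Casoratian theorem of the tree so far is a LOWER bound; this file is the reusable tool in the other direction (its first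
instance — the X1-sliver witness, decided in the kernel — is the companion file `CasDigitX1Sliver`).
Setting = regimes H0 / T of `CollinearityDigits` / `CollinearityCriterionProof` (`N ≥ 3`; every pole class strictly deeper than `−N`
is a tame single-pole class; `5 ≤ p ≤ min(b₀, d)`, `b₀ + 2 < p²`).  With the normalised sums `K̃ = (−p)^{N−3}𝒦_p`, `Ṽ = (−p)^N V`
(`cast_kTilde`, `cast_vTilde`: `p`-integral, images the deep digit sums) one has, exactly as in `collinearityCriterionT_holds`,
`Cas_j(b) = −(−p)^{3−2N}·(K̃⁺Ṽ − K̃Ṽ⁺)` (`p ≤ d`, `omegaRes_eq_zero`) and the image of `K̃⁺Ṽ − K̃Ṽ⁺` in `ZMod p` is the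
FIRST-DIGIT DETERMINANT `casDigitDet b p j N = (Σ_{x deep} π̄_j(x) ḡ_x σ̄_K(x))(Σ ḡ_x v̄_x) − (Σ ḡ_x σ̄_K(x))(Σ π̄_j(x) ḡ_x v̄_x)`,
`π_j(x) = (b_j − x)(b₀ − b_j − x)` (`sum_unhit_shift_eq`).  Hence **`casSharpnessT`: if `casDigitDet b p j N ≠ 0` then `Cas_j(b) ≠ 0`
and `v_p(Cas_j(b)) = 3 − 2N`** — no collinearity, moment or multipole hypothesis is needed; since `casLB ≤ 3 − 2N` (`casLB_le_of_deep`)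
the class bound is then ATTAINED whenever `casLB = 3 − 2N` (`casSharpness_eq_casLB`); `casSharpnessH0` is the regime-H0 form
(`∀ x, E_x ≥ −N`).  Standard axioms.  `p`-adic valuations of rational numbers; nothing here bears on irrationality — records unmoved
(0.85488 PROVED / 0.86597135 cond. BZ), certified candidates 0.
-/

noncomputable section

open Finset

namespace Summit.KontsevichZagierPeriods.Zeta5Search.ClusterValuation

open Summit.KontsevichZagierPeriods.Zeta5Search.DualSeries (InBox)
open Summit.KontsevichZagierPeriods.Zeta5Search.WedgeDictionary (coeffV dOf)
open Summit.KontsevichZagierPeriods.Zeta5Search.CasoratianValuation (InPolytope shift casoratian)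
open Summit.KontsevichZagierPeriods.Zeta5Search.BigPrime (shift_zero)
open Summit.KontsevichZagierPeriods.Zeta5Search.PadicSeries

variable {p : ℕ} [hp : Fact p.Prime]

/-! ## §1  The first-digit determinant -/

/-- The **FIRST-DIGIT DETERMINANT** of the depth-`N` classes of `b` in direction `e_j`: the `ZMod p` image of `K̃⁺Ṽ − K̃Ṽ⁺`
(`π̄_j(x) = (b_j − x)(b₀ − b_j − x)` vanishes exactly on the classes hit by the shift; literally the determinant of
`collinearityCriterionT_holds`, where it is shown to VANISH under collinearity). -/
def casDigitDet (b : ℕ → ℤ) (p j N : ℕ) [Fact p.Prime] : ZMod p :=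
  (∑ x ∈ deepClasses b p N, ((((b j : ℤ) : ZMod p) - x) * (((b 0 - b j : ℤ) : ZMod p) - x)) *
      (((gHat b p x : ℚ) : ZMod p) * ((sigmaK b p x : ℚ) : ZMod p))) *
    (∑ x ∈ deepClasses b p N, ((gHat b p x : ℚ) : ZMod p) * ((vHat b p x : ℚ) : ZMod p)) -
  (∑ x ∈ deepClasses b p N, ((gHat b p x : ℚ) : ZMod p) * ((sigmaK b p x : ℚ) : ZMod p)) *
    (∑ x ∈ deepClasses b p N, ((((b j : ℤ) : ZMod p) - x) * (((b 0 - b j : ℤ) : ZMod p) - x)) *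
      (((gHat b p x : ℚ) : ZMod p) * ((vHat b p x : ℚ) : ZMod p)))

/-! ## §2  A `p`-integral rational with non-zero image has valuation `0` -/

/-- A `p`-integral rational whose image in `ZMod p` is non-zero is non-zero and has `p`-adic valuation `0`. -/
theorem PInt.val_eq_zero_of_cast_ne_zero {r : ℚ} (hr : ¬ p ∣ r.den) (h : (r : ZMod p) ≠ 0) :
    r ≠ 0 ∧ padicValRat p r = 0 := by
  refine ⟨?_, ?_⟩
  · rintro rfl
    exact h (by simp)
  · have hnum : ¬ (p : ℤ) ∣ r.num := fun hdvd => h (by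
      rw [Rat.cast_def, div_eq_zero_iff]
      exact Or.inl ((ZMod.intCast_zmod_eq_zero_iff_dvd _ p).2 hdvd))
    rw [padicValRat, padicValInt.eq_zero_of_not_dvd hnum, padicValNat.eq_zero_of_not_dvd hr]
    simp

/-! ## §3  The sharpness theorem -/

/-- **SHARPNESS OF THE FIRST DIGIT (regimes H0 and T).**  If `5 ≤ p ≤ min(b₀, d)`, `b₀ + 2 < p²`, `N ≥ 3`, every pole class of `b`
strictly deeper than `−N` is a tame single-pole class, and the first-digit determinant `casDigitDet b p j N` is a unit of `ZMod p`, then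
`Cas_j(b) ≠ 0` and `v_p(Cas_j(b)) = 3 − 2N` exactly. -/
theorem casSharpnessT (b : ℕ → ℤ) (j N : ℕ) (hb : InPolytope b) (hb' : InPolytope (shift b j)) (hj1 : 1 ≤ j) (hj7 : j ≤ 7)
    (hp5 : 5 ≤ p) (hpb : (p : ℤ) ≤ b 0) (hpd : (p : ℤ) ≤ dOf b) (hwin : (b 0 + 2 : ℤ) < (p : ℤ) ^ 2) (hN : 3 ≤ N)
    (hT : ∀ x, x < p → classExp b p x < -(N : ℤ) → classPoleCount b p x = 1 ∧ tameSingle b p x = true)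
    (hdig : casDigitDet b p j N ≠ 0) :
    casoratian b j ≠ 0 ∧ padicValRat p (casoratian b j) = 3 - 2 * (N : ℤ) := by
  classical
  have hprime := hp.out
  have hp0 : 0 < p := hprime.pos
  have hbox : InBox b := hb.1
  have h0 : 0 ≤ b 0 := hbox.1
  set n := (b 0).toNat with hn
  have hnZ : ((n : ℕ) : ℤ) = b 0 := Int.toNat_of_nonneg h0
  have hpn : p ≤ n := by omega
  obtain ⟨-, -, -, hnp2⟩ := thmA_data b hb hwin
  have hp2 : p ≠ 2 := by omega
  have hN1 : 1 ≤ N := by omega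
  have hwin' : (shift b j 0 + 2 : ℤ) < (p : ℤ) ^ 2 := by rwa [shift_zero b hj1]
  have h2j : 2 * b j ≤ b 0 := CellKit.two_mul_le_of_shift b hj1 hj7 hb'
  have hp' : (-(p : ℚ)) ≠ 0 := neg_ne_zero.2 (Nat.cast_ne_zero.2 hprime.ne_zero)
  -- regime T for `b`: deeper classes are tame single-pole classes
  have hnu_of : ∀ x, classPoleCount b p x = 1 → tameSingle b p x = true → 0 ≤ classNu b p x := by
    intro x h1 ht
    unfold classNu; rw [if_pos ⟨h1, ht⟩]; exact le_max_right _ _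
  have hTb : ∀ x, x < p → 1 ≤ classPoleCount b p x → classExp b p x < -(N : ℤ) →
      classPoleCount b p x = 1 ∧ 0 ≤ classNu b p x := by
    intro x hx _ hlt
    obtain ⟨h1, ht⟩ := hT x hx hlt
    exact ⟨h1, hnu_of x h1 ht⟩
  -- the selected classes: all deep classes of `b`; the unhit deep classes for `b + e_j`
  set D := deepClasses b p N with hD
  have hDsub : D ⊆ range p := filter_subset _ _
  have hsel : ∀ x ∈ D, classExp b p x = -(N : ℤ) := fun x hx => (mem_filter.1 hx).2
  have hnsel : ∀ x, x < p → x ∉ D → classExp b p x = -(N : ℤ) → 1 ≤ classPoleCount b p x →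
      classPoleCount b p x = 1 ∧ 0 ≤ classNu b p x :=
    fun x hx hxD hE _ => absurd (mem_filter.2 ⟨mem_range.2 hx, hE⟩) hxD
  set U := D.filter (fun x => (b j).toNat ∉ classSet b p x ∧ (b 0).toNat - (b j).toNat ∉ classSet b p x) with hU
  have hUsub : U ⊆ range p := (filter_subset _ _).trans hDsub
  have hTb' : ∀ x, x < p → 1 ≤ classPoleCount (shift b j) p x → classExp (shift b j) p x < -(N : ℤ) →
      classPoleCount (shift b j) p x = 1 ∧ 0 ≤ classNu (shift b j) p x := by
    intro x hx hpos' hlt'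
    have hlt : classExp b p x < -(N : ℤ) := lt_of_le_of_lt (classExp_shift_ge b hbox hj1 p x) hlt'
    obtain ⟨h1, ht⟩ := hT x hx hlt
    have hle := classPoleCount_shift_le b hbox hj1 p x
    exact ⟨by omega, (hnu_of x h1 ht).trans (classNu_shift_ge b hbox hj1 hpos')⟩
  have hsel' : ∀ x ∈ U, classExp (shift b j) p x = -(N : ℤ) := by
    intro x hx
    obtain ⟨hxD, hu1, hu2⟩ := mem_filter.1 hx
    rw [classExp_shift_of_unhit b hbox hj1 hj7 h2j hu1 hu2]
    exact hsel x hxD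
  have hnsel' : ∀ x, x < p → x ∉ U → classExp (shift b j) p x = -(N : ℤ) → 1 ≤ classPoleCount (shift b j) p x →
      classPoleCount (shift b j) p x = 1 ∧ 0 ≤ classNu (shift b j) p x := by
    intro x hx hxU hE' hpos'
    have hge := classExp_shift_ge b hbox hj1 p x
    rcases lt_or_eq_of_le (show classExp b p x ≤ -(N : ℤ) by omega) with hlt | heq
    · obtain ⟨h1, ht⟩ := hT x hx hlt
      have hle := classPoleCount_shift_le b hbox hj1 p x
      exact ⟨by omega, (hnu_of x h1 ht).trans (classNu_shift_ge b hbox hj1 hpos')⟩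
    · exfalso
      have hxD : x ∈ D := mem_filter.2 ⟨mem_range.2 hx, heq⟩
      by_cases hhit : (b j).toNat ∈ classSet b p x ∨ (b 0).toNat - (b j).toNat ∈ classSet b p x
      · have := classExp_shift_of_hit b hbox hj1 hj7 h2j hhit
        omega
      · push Not at hhit
        exact hxU (mem_filter.2 ⟨hxD, hhit.1, hhit.2⟩)
  -- the four normalised sums and their images
  obtain ⟨hKden, hKcast⟩ := cast_kTilde b hb hp5 hwin hN hTb D hDsub hsel hnsel
  obtain ⟨hVden, hVcast⟩ := cast_vTilde b hb hp5 hwin hN hTb D hDsub hsel hnsel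
  obtain ⟨hK'den, hK'cast⟩ := cast_kTilde (shift b j) hb' hp5 hwin' hN hTb' U hUsub hsel' hnsel'
  obtain ⟨hV'den, hV'cast⟩ := cast_vTilde (shift b j) hb' hp5 hwin' hN hTb' U hUsub hsel' hnsel'
  rw [hU, sum_unhit_shift_eq b hb hb' hj1 hj7 hp5 hN1 (fun x => ((sigmaK b p x : ℚ) : ZMod p))
      (fun x => ((sigmaK (shift b j) p x : ℚ) : ZMod p))
      (fun x _ hE => by rw [sigmaK_shift_of_classExp_eq b hbox hj1 hE])] at hK'cast
  rw [hU, sum_unhit_shift_eq b hb hb' hj1 hj7 hp5 hN1 (fun x => ((vHat b p x : ℚ) : ZMod p))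
      (fun x => ((vHat (shift b j) p x : ℚ) : ZMod p))
      (fun x _ hE => by rw [vHat_shift_of_classExp_eq b hbox hj1 hE])] at hV'cast
  -- the normalised determinant: `p`-integral, image = the digit determinant, hence non-zero of valuation `0`
  set Kt := (-(p : ℚ)) ^ ((N : ℤ) - 3) * kRes b p with hKt
  set Kt' := (-(p : ℚ)) ^ ((N : ℤ) - 3) * kRes (shift b j) p with hKt'
  set Vt := (-(p : ℚ)) ^ (N : ℤ) * coeffV b with hVt
  set Vt' := (-(p : ℚ)) ^ (N : ℤ) * coeffV (shift b j) with hVt'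
  have hDden : ¬ p ∣ (Kt' * Vt - Kt * Vt').den := PInt.sub (PInt.mul hK'den hVden) (PInt.mul hKden hV'den)
  have hDcast : ((Kt' * Vt - Kt * Vt' : ℚ) : ZMod p) = casDigitDet b p j N := by
    rw [PInt.cast_sub (PInt.mul hK'den hVden) (PInt.mul hKden hV'den), PInt.cast_mul hK'den hVden,
      PInt.cast_mul hKden hV'den, hKcast, hVcast, hK'cast, hV'cast]
    simp only [casDigitDet, hD, mul_assoc]
  have hDne : ((Kt' * Vt - Kt * Vt' : ℚ) : ZMod p) ≠ 0 := by rwa [hDcast]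
  obtain ⟨hQne, hval0⟩ := PInt.val_eq_zero_of_cast_ne_zero hDden hDne
  -- `Cas_j = −(−p)^{3−2N}·(K̃⁺Ṽ − K̃Ṽ⁺)` for `p ≤ d`
  have hΩ : omegaRes b p = 0 := omegaRes_eq_zero b hb (by omega)
  have hΩ' : omegaRes (shift b j) p = 0 :=
    omegaRes_eq_zero (shift b j) hb' (by rw [BigPrime.dOf_shift b hj1 hj7]; omega)
  have hB : kRes (shift b j) p * coeffV b - kRes b p * coeffV (shift b j) =
      (-(p : ℚ)) ^ (3 - 2 * (N : ℤ)) * (Kt' * Vt - Kt * Vt') := by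
    have e1 : (-(p : ℚ)) ^ (3 - 2 * (N : ℤ)) * ((-(p : ℚ)) ^ ((N : ℤ) - 3) * (-(p : ℚ)) ^ (N : ℤ)) = 1 := by
      rw [← zpow_add₀ hp', ← zpow_add₀ hp', show (3 - 2 * (N : ℤ) + ((N : ℤ) - 3 + N)) = 0 by ring, zpow_zero]
    simp only [hKt, hKt', hVt, hVt']
    linear_combination (kRes b p * coeffV (shift b j) - kRes (shift b j) p * coeffV b) * e1
  have hcasB : casoratian b j = -((-(p : ℚ)) ^ (3 - 2 * (N : ℤ)) * (Kt' * Vt - Kt * Vt')) := by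
    rw [casoratian_split b j p, hΩ, hΩ', hB]; ring
  -- the valuation
  have hpow : (-(p : ℚ)) ^ (3 - 2 * (N : ℤ)) ≠ 0 := zpow_ne_zero _ hp'
  refine ⟨by rw [hcasB]; exact neg_ne_zero.2 (mul_ne_zero hpow hQne), ?_⟩
  rw [hcasB, padicValRat.neg, padicValRat.mul hpow hQne, hval0, add_zero, padicValRat.zpow, padicValRat.neg,
    padicValRat.self hprime.one_lt, mul_one]

/-- **The class bound is attained**: under the hypotheses of `casSharpnessT`, whenever the Casoratian class bound `casLB b p` equals
`3 − 2N` (e.g. regime H0 with a multipole class at depth `−N` and `VB = −N`; in general only `casLB ≤ 3 − 2N`, `casLB_le_of_deep`),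
a unit digit determinant gives `v_p(Cas_j(b)) = casLB b p` on the nose. -/
theorem casSharpness_eq_casLB (b : ℕ → ℤ) (j N : ℕ) (hb : InPolytope b) (hb' : InPolytope (shift b j)) (hj1 : 1 ≤ j) (hj7 : j ≤ 7)
    (hp5 : 5 ≤ p) (hpb : (p : ℤ) ≤ b 0) (hpd : (p : ℤ) ≤ dOf b) (hwin : (b 0 + 2 : ℤ) < (p : ℤ) ^ 2) (hN : 3 ≤ N)
    (hT : ∀ x, x < p → classExp b p x < -(N : ℤ) → classPoleCount b p x = 1 ∧ tameSingle b p x = true)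
    (hLB : casLB b p = 3 - 2 * (N : ℤ)) (hdig : casDigitDet b p j N ≠ 0) :
    casoratian b j ≠ 0 ∧ padicValRat p (casoratian b j) = casLB b p := by
  rw [hLB]; exact casSharpnessT b j N hb hb' hj1 hj7 hp5 hpb hpd hwin hN hT hdig

/-- **Regime H0 form** (no class deeper than `−N`): the tame-class hypothesis is vacuous. -/
theorem casSharpnessH0 (b : ℕ → ℤ) (j N : ℕ) (hb : InPolytope b) (hb' : InPolytope (shift b j)) (hj1 : 1 ≤ j) (hj7 : j ≤ 7)
    (hp5 : 5 ≤ p) (hpb : (p : ℤ) ≤ b 0) (hpd : (p : ℤ) ≤ dOf b) (hwin : (b 0 + 2 : ℤ) < (p : ℤ) ^ 2) (hN : 3 ≤ N)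
    (hEN : ∀ x, x < p → -(N : ℤ) ≤ classExp b p x) (hdig : casDigitDet b p j N ≠ 0) :
    casoratian b j ≠ 0 ∧ padicValRat p (casoratian b j) = 3 - 2 * (N : ℤ) :=
  casSharpnessT b j N hb hb' hj1 hj7 hp5 hpb hpd hwin hN (fun x hx hlt => absurd (hEN x hx) (not_le.2 hlt)) hdig

end Summit.KontsevichZagierPeriods.Zeta5Search.ClusterValuation

end
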